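import Literature.AlgebraicGeometry.HodgeTheory.FermatClaimPermutationInvariance
import Literature.AlgebraicGeometry.HodgeTheory.FermatInductiveClaimsProofs
import Literature.AlgebraicGeometry.HodgeTheory.SupportedHodgeClassesAlgebraic
import Literature.AlgebraicGeometry.HodgeTheory.AlgebraicClassesExteriorProduct
import Literature.AlgebraicGeometry.HodgeTheory.GysinKernelProofs
import HarnessLib

/-!
# Shioda's type-II correspondence on the real Gysin maps: `φ_* π^*(alg ⊠ alg) ⊆ alg`, and Aoki's Thm. 1-4 (i) from a type-II span

Family `hodge`, layer `Literature/AlgebraicGeometry/HodgeTheory`. Proof file (D-0026: everything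
here is PROVED; no named fact is introduced; one auxiliary definition `typeIISpanMap` packaging a
composite of existing maps) towards the named fact `Aoki1987_claim_juxtaposition` (Aoki, J. Math.
Soc. Japan 39 (1987) Thm. 1-4 (i) = Shioda, Math. Ann. 245 (1979) Thm. I / da Silva,
arXiv:2101.04739 Thm. 2.2 (S) and Cor. 2.3 (a)), continuing `FermatClaimPermutationInvariance`
(whose `FermatCharacter.Claim.append_of_typeII` reduced claim(α∗β) to two hypotheses (hΦA), (hΦV)
on an ABSTRACT bilinear `Φ`) by realising `Φ` GEOMETRICALLY and DISCHARGING (hΦA).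

The printed type-II morphism (da Silva Thm. 2.2; Shioda–Katsura, Tôhoku Math. J. 31 (1979) §1):
for `n = r' + s' + 2` the two sub-Fermat varieties `X1 = Xⁿₘ ∩ {y = 0} ≅ X^{r'}ₘ`,
`X2 = Xⁿₘ ∩ {x = 0} ≅ X^{s'}ₘ` span complementary linear subspaces, every line joining them lies
on `Xⁿₘ`, and with `E → X1 × X2` the `ℙ¹`-bundle of these lines and `φ : E → Xⁿₘ`,
"`f(Z₁ ⊗ Z₂) = m Z₁ ∧ Z₂`", `f = φ_* ∘ π^*`, carries `V(β′) ⊗ V(γ′)` onto `V(β′∗γ′)` and pairs of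
algebraic cycles to the ruled join, an algebraic cycle. On the tree's REAL carriers
(`complexBetti = H*(–(ℂ); ℂ)`, `algebraicClasses = Nᵖ H²ᵖ`, the unconditional Gysin morphisms
`complexGysin μ` of `ComplexGysin` — Poincaré duality being the tree's theorem
`OrientationFamily.hasPoincareDuality` — flat pull-backs and the exterior product):

* `complexGysin_map_mem_algebraicClasses_of_flat` — **spans transport algebraic classes**: for a
  span `Y ←π— E —φ→ X` of smooth projective varieties with `π` flat,
  `φ_*(π^*(Nᵏ H²ᵏ(Y))) ⊆ Nᶜ H²ᶜ(X)`, `c = k + dim X - dim E` (flat pull-back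
  `map_mem_algebraicClasses_of_flat`, Hartshorne III 9.5, then the support form of the proper
  push-forward `complexGysin_mem_supportedClasses`, Fulton, *Young Tableaux* App. B §B.2 Ex. 5);
  `complexGysin_map_exterior_mem_algebraicClasses` — the same for `Y = V ⊗ V'` and an exterior
  product `pr_V^* a ∪ pr_{V'}^* b` of algebraic classes (`cupProduct_map_fst_map_snd_mem_algebraicClasses`,
  Voisin II, proof of Prop. 9.20); `complexGysin_one_mem_algebraicClasses` — `φ_* 1 ∈ Nᶜ H²ᶜ(X)`,
  `c = dim X - dim E` (the class of the image subvariety, Fulton App. B §B.3).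
* `FermatCharacter.typeIISpanMap μ hE hX π φ he` — **the type-II map of a span**
  `X²ʳₘ ⊗ X²ˢₘ ←π— E —φ→ X^{2(r+s+1)}ₘ` (`dim E + 1 = 2(r+s+1)`, `π` flat):
  `(v, w) ↦ φ_*(π^*(pr₁^* v ∪ pr₂^* w)) : H²ʳ(X²ʳₘ) × H²ˢ(X²ˢₘ) → H^{2(r+s+1)}(X^{2(r+s+1)}ₘ)`
  (for Shioda's `E` = the `ℙ¹`-bundle of joining lines this is da Silva's `f` of type II);
  `typeIISpanMap_mem_algebraicClasses` — **(hΦA) discharged**: it takes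
  `algebraicClasses _ r × algebraicClasses _ s` into `algebraicClasses _ (r + s + 1)`.
* `FermatCharacter.Claim.append_of_typeIISpan` — claim(α) ∧ claim(β) ⟹ claim(α∗β) GRANTED the
  remaining half (hΦV) of Shioda's Thm. I for the span: `V(α∗β) ⊆ span Φ(V(α) × V(β))`
  ("`f` is a `Gⁿₘ`-equivariant isomorphism onto `Hⁿ_prim` and the `(α∗β)`-isotypic part of its
  source is `V(α) ⊗ V(β)`"). No eigenspace-dimension input is needed on this road.
* `FermatCharacter.Claim.append_of_typeIISpan_represents` — the same conclusion from the WEAKER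
  geometric input "some `Φ(v, w)`, `v ∈ V(α)`, `w ∈ V(β)`, has a non-zero `(α∗β)`-component"
  (Aoki p. 386: the join `Z₁ ∧ Z₂` REPRESENTS `α∗β`) together with `dim V(α∗β) ≤ 1` (Aoki p. 385
  "well known"; Ran, Compositio Math. 42 (1980) Prop. 1.7 (i); the hypothesis `hE1` shared by all
  assemblies of this layer), through `FermatCharacter.claim_of_represents`.
* `Aoki1987_claim_juxtaposition_of_spans` — **the named fact from its geometric inputs**: `hE1`
  (`dim V(γ) ≤ 1`) and, for every pair of Hodge characters, a representing type-II span (cone span,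
  line for `r = 0` / `s = 0`), assembled through `Aoki1987_claim_juxtaposition_of_append`.
* `FermatCharacter.Claim.append_of_coneSpan_represents_left/right` — the same for `r = 0`
  (resp. `s = 0`), where `X⁰ₘ` is `m` points and the joining lines form cones over `X²ˢₘ`: a span
  `X²ˢₘ ←π— E —φ→ X^{2(s+1)}ₘ` (one completed cone `E = ℙ(O ⊕ O(-1))` per point of `X⁰ₘ` in print).

## What is NOT here (recorded in the seat's notes as routes A/B/C)

The span itself — Shioda's `E = ℙ(O_{X1}(-1) ⊞ O_{X2}(-1))` with its two morphisms, or the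
Shioda–Katsura blow-up `Z = Bl_{X1×X2}(X^{2r+1}ₘ × X^{2s+1}ₘ) → Xⁿₘ` of degree `m` — as a smooth
projective `ℂ`-scheme (multi-projective incidence varieties are not in Mathlib), and either of the
two inputs closing the argument: (hΦV) (Shioda's isomorphism theorem: blow-up formula, Künneth on
the real carriers, `Ψ_*Ψ^* = m`), or the non-vanishing of the `(α∗β)`-component of `Φ(v, w)`
(excess intersection along the two exceptional sections / residues) with `dim V(α∗β) ≤ 1`
(Pham–Brieskorn, in progress in `FermatAffineChart`). Hence `Aoki1987_claim_juxtaposition_holds` is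
NOT here.

## References

* [Aoki1987] N. Aoki, Some new algebraic cycles on Fermat varieties, J. Math. Soc. Japan 39 (1987)
  385–396, Thm. 1-4 (i) p. 388; p. 385 (`dim V(α) = 1`); p. 386 (represents ⟹ claim) (text read).
* [Shioda1979HodgeFermat] T. Shioda, The Hodge conjecture for Fermat varieties, Math. Ann. 245
  (1979) 175–184, Thm. I (cite-only; restated as da Silva Thm. 2.2).
* [daSilva2021HodgeFermat] G. da Silva Jr., Notes on the Hodge Conjecture for Fermat Varieties,
  arXiv:2101.04739, Thm. 2.2 (S) (a)–(c), Cor. 2.3 (a) (text read).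
* [Ran1980] Z. Ran, Cycles on Fermat hypersurfaces, Compositio Math. 42 (1980), Prop. 1.7 (i).
* [FultonYoungTableaux1997] W. Fulton, Young Tableaux, App. B §B.2 Exercise 5, §B.3.
* [VoisinHodgeII2003] C. Voisin, Hodge Theory and Complex Algebraic Geometry II, proof of Prop. 9.20.
* [Hartshorne1977] R. Hartshorne, Algebraic Geometry, III Prop. 9.5.
-/

noncomputable section

open CategoryTheory AlgebraicGeometry MonoidalCategory CartesianMonoidalCategory
open Literature.AlgebraicTopology.SingularHomology

namespace Literature.AlgebraicGeometry.HodgeTheory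

open Literature.AlgebraicGeometry.Motives

/-! ### Spans of smooth projective varieties transport algebraic classes -/

section Transport

variable (μ : OrientationFamily) {e dY d d' dX : ℕ} {E Y V V' X : Motives.SchemeOver ℂ}

/-- **Spans transport algebraic classes.** For smooth projective `E`, `Y`, `X` of dimensions `e`,
`dY`, `dX`, a FLAT `π : E ⟶ Y` and any `φ : E ⟶ X`: if `a ∈ Nᵏ H²ᵏ(Y(ℂ); ℂ)` then
`φ_*(π^* a) ∈ Nᶜ H²ᶜ(X(ℂ); ℂ)` for `k + dX = c + e` — flat pull-back preserves the support
filtration (Hartshorne III 9.5) and proper push-forward shifts it by the relative dimension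
(Fulton App. B §B.2 Ex. 5, the tree's `complexGysin_mem_supportedClasses` fed with the PROVED
support fact `gysinMap_restrictCompl_eq_zero_of_field ℂ` and Poincaré duality
`OrientationFamily.hasPoincareDuality`). This is the mechanism "`f(Z₁ ⊗ Z₂) = m Z₁ ∧ Z₂` is an
algebraic cycle" of the type-II morphism read on supports.
[cite: daSilva2021HodgeFermat, Thm. 2.2 (b)] [cite: FultonYoungTableaux1997, Appendix B §B.2 Exercise 5]
[cite: Hartshorne1977, III Prop. 9.5] -/
theorem complexGysin_map_mem_algebraicClasses_of_flat (hE : IsSmoothProjective e E)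
    (hY : IsSmoothProjective dY Y) (hX : IsSmoothProjective dX X) (π : E ⟶ Y) [Flat π.left]
    (φ : E ⟶ X) {k c : ℕ} (hc : k + dX = c + e) {a : complexBetti Y (2 * k)}
    (ha : a ∈ algebraicClasses Y k) :
    complexGysin μ hE hX φ (show 2 * k + 2 * dX = 2 * c + 2 * e by omega)
        (complexBetti.map π (2 * k) a) ∈ algebraicClasses X c := by
  haveI : IsLocallyNoetherian E.left := IsSmoothProjective.isLocallyNoetherian_holds hE
  haveI : IsLocallyNoetherian Y.left := IsSmoothProjective.isLocallyNoetherian_holds hY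
  have hπ : complexBetti.map π (2 * k) a ∈ algebraicClasses E k := map_mem_algebraicClasses_of_flat π ha
  exact complexGysin_mem_supportedClasses (gysinMap_restrictCompl_eq_zero_of_field ℂ) μ
    (OrientationFamily.hasPoincareDuality μ) hE hX φ _ (by omega) hπ

/-- **Spans out of a product transport exterior products of algebraic classes**: for a flat
`π : E ⟶ V ⊗ V'` and `φ : E ⟶ X` (all smooth projective, dimensions `e`, `d`, `d'`, `dX`),
`a ∈ Nˡ H²ˡ(V)`, `b ∈ Nᵏ H²ᵏ(V')` and `(l + k) + dX = c + e`:
`φ_*(π^*(pr_V^* a ∪ pr_{V'}^* b)) ∈ Nᶜ H²ᶜ(X)` (exterior products of algebraic classes are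
algebraic, Voisin II proof of Prop. 9.20 — the tree's `cupProduct_map_fst_map_snd_mem_algebraicClasses`
— then `complexGysin_map_mem_algebraicClasses_of_flat`). For Shioda's `ℙ¹`-bundle of joining
lines this is "`Z₁ ∧ Z₂`, the algebraic cycle obtained by joining `Z₁` and `Z₂` by lines, is
algebraic". [cite: daSilva2021HodgeFermat, Thm. 2.2 (b)] [cite: VoisinHodgeII2003, proof of Prop. 9.20 (first display)] -/
theorem complexGysin_map_exterior_mem_algebraicClasses (hE : IsSmoothProjective e E)
    (hV : IsSmoothProjective d V) (hV' : IsSmoothProjective d' V') (hX : IsSmoothProjective dX X)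
    (π : E ⟶ V ⊗ V') [Flat π.left] (φ : E ⟶ X) {l k c : ℕ} (hc : (l + k) + dX = c + e)
    {a : complexBetti V (2 * l)} (ha : a ∈ algebraicClasses V l) {b : complexBetti V' (2 * k)}
    (hb : b ∈ algebraicClasses V' k) :
    complexGysin μ hE hX φ (show 2 * (l + k) + 2 * dX = 2 * c + 2 * e by omega)
        (complexBetti.map π (2 * (l + k))
          (cupProduct (two_mul_add_two_mul l k) (complexBetti.map (fst V V') (2 * l) a)
            (complexBetti.map (snd V V') (2 * k) b))) ∈ algebraicClasses X c :=
  complexGysin_map_mem_algebraicClasses_of_flat μ hE (IsSmoothProjective.tensor_holds hV hV') hX π φ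
    hc (cupProduct_map_fst_map_snd_mem_algebraicClasses hV hV' ha hb)

/-- **The push-forward of `1` is algebraic**: for `φ : E ⟶ X` of smooth projective varieties of
dimensions `e ≤ dX`, `φ_* 1_E ∈ Nᶜ H²ᶜ(X(ℂ); ℂ)`, `c = dX - e` (the class "`[V]` in `H^{2c}X`" of
the image; `1 ∈ N⁰ H⁰ = H⁰` and Gysin images are supported on the image). For a LINE
`ℓ ≅ ℙ¹ → X²ₘ` joining a point of `X⁰ₘ × X⁰ₘ` this is the class of one of Shioda's lines on the
Fermat surface. [cite: FultonYoungTableaux1997, Appendix B §B.2 Exercise 5 and §B.3] -/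
theorem complexGysin_one_mem_algebraicClasses (hE : IsSmoothProjective e E)
    (hX : IsSmoothProjective dX X) (φ : E ⟶ X) {c : ℕ} (hc : dX = c + e) :
    complexGysin μ hE hX φ (show 0 + 2 * dX = 2 * c + 2 * e by omega)
        (singularCohomology.one ℂ (Motives.ComplexPoints E)) ∈ algebraicClasses X c :=
  complexGysin_mem_supportedClasses (gysinMap_restrictCompl_eq_zero_of_field ℂ) μ
    (OrientationFamily.hasPoincareDuality μ) hE hX φ _ (r := 0) (by omega)
    (by rw [supportedClasses_zero]; exact Submodule.mem_top)

end Transport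

/-! ### The type-II map of a span `X²ʳₘ ⊗ X²ˢₘ ← E → X^{2(r+s+1)}ₘ` -/

namespace FermatCharacter

section TypeII

variable {m r s : ℕ} (μ : OrientationFamily) {e : ℕ} {E : Motives.SchemeOver ℂ}

/-- **The type-II map of a span.** For a span `X²ʳₘ ⊗ X²ˢₘ ←π— E —φ→ X^{2(r+s+1)}ₘ` of smooth
projective varieties with `dim E + 1 = 2(r+s+1)` (intended: Shioda's `ℙ¹`-bundle `E → X1 × X2` of
the lines joining the two complementary sub-Fermat varieties `X1 = {y = 0}`, `X2 = {x = 0}` of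
`X^{2(r+s+1)}ₘ`, and `φ` the tautological map onto the ruled join), the bilinear map
`Φ(v, w) = φ_*(π^*(pr₁^* v ∪ pr₂^* w)) : H²ʳ(X²ʳₘ) × H²ˢ(X²ˢₘ) → H^{2(r+s+1)}(X^{2(r+s+1)}ₘ)` —
da Silva's `f` of type II ("`f(Z₁ ⊗ Z₂) = m Z₁ ∧ Z₂`"), on the tree's real Gysin maps
`complexGysin μ`. [cite: daSilva2021HodgeFermat, Thm. 2.2 (S)] [cite: Shioda1979HodgeFermat, Thm. I] -/
def typeIISpanMap (hE : IsSmoothProjective e E)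
    (hX : IsSmoothProjective (2 * (r + s + 1)) (fermatHypersurface (2 * (r + s + 1)) m))
    (π : E ⟶ fermatHypersurface (2 * r) m ⊗ fermatHypersurface (2 * s) m)
    (φ : E ⟶ fermatHypersurface (2 * (r + s + 1)) m) (he : e + 1 = 2 * (r + s + 1)) :
    complexBetti (fermatHypersurface (2 * r) m) (2 * r) →ₗ[ℂ]
      complexBetti (fermatHypersurface (2 * s) m) (2 * s) →ₗ[ℂ]
        complexBetti (fermatHypersurface (2 * (r + s + 1)) m) (2 * (r + s + 1)) :=
  (((LinearMap.lcomp ℂ _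
      (complexBetti.map (snd (fermatHypersurface (2 * r) m) (fermatHypersurface (2 * s) m))
        (2 * s)).hom) ∘ₗ
    (cupProduct (two_mul_add_two_mul r s)) ∘ₗ
      (complexBetti.map (fst (fermatHypersurface (2 * r) m) (fermatHypersurface (2 * s) m))
        (2 * r)).hom).compr₂
    (complexGysin μ hE hX φ (show 2 * (r + s) + 2 * (2 * (r + s + 1)) = 2 * (r + s + 1) + 2 * e by omega) ∘ₗ
      (complexBetti.map π (2 * (r + s))).hom))

variable {μ}

/-- Pointwise formula: `Φ(v, w) = φ_*(π^*(pr₁^* v ∪ pr₂^* w))`. [cite: daSilva2021HodgeFermat, Thm. 2.2 (S)] -/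
theorem typeIISpanMap_apply (hE : IsSmoothProjective e E)
    (hX : IsSmoothProjective (2 * (r + s + 1)) (fermatHypersurface (2 * (r + s + 1)) m))
    (π : E ⟶ fermatHypersurface (2 * r) m ⊗ fermatHypersurface (2 * s) m)
    (φ : E ⟶ fermatHypersurface (2 * (r + s + 1)) m) (he : e + 1 = 2 * (r + s + 1))
    (v : complexBetti (fermatHypersurface (2 * r) m) (2 * r))
    (w : complexBetti (fermatHypersurface (2 * s) m) (2 * s)) :
    typeIISpanMap μ hE hX π φ he v w =
      complexGysin μ hE hX φ
        (show 2 * (r + s) + 2 * (2 * (r + s + 1)) = 2 * (r + s + 1) + 2 * e by omega)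
        (complexBetti.map π (2 * (r + s))
          (cupProduct (two_mul_add_two_mul r s)
            (complexBetti.map (fst (fermatHypersurface (2 * r) m) (fermatHypersurface (2 * s) m))
              (2 * r) v)
            (complexBetti.map (snd (fermatHypersurface (2 * r) m) (fermatHypersurface (2 * s) m))
              (2 * s) w))) :=
  rfl

/-- **(hΦA) discharged: the type-II map of a span takes pairs of algebraic classes to algebraic
classes** — `Φ(Nʳ H²ʳ(X²ʳₘ) × Nˢ H²ˢ(X²ˢₘ)) ⊆ N^{r+s+1} H^{2(r+s+1)}(X^{2(r+s+1)}ₘ)` for `π` flat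
and `r, s ≥ 1`, `m ≥ 1` (exterior product, flat pull-back, proper push-forward shifting the
codimension by `dim X - dim E = 1`): "`f(Z₁ ⊗ Z₂) = m Z₁ ∧ Z₂`, where `Z₁ ∧ Z₂` is the algebraic
cycle obtained by joining `Z₁` and `Z₂` by lines". [cite: daSilva2021HodgeFermat, Thm. 2.2 (b)]
[cite: Shioda1979HodgeFermat, Thm. I] -/
theorem typeIISpanMap_mem_algebraicClasses [NeZero m] (hr : 1 ≤ r) (hs : 1 ≤ s)
    (hE : IsSmoothProjective e E)
    (hX : IsSmoothProjective (2 * (r + s + 1)) (fermatHypersurface (2 * (r + s + 1)) m))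
    (π : E ⟶ fermatHypersurface (2 * r) m ⊗ fermatHypersurface (2 * s) m) [Flat π.left]
    (φ : E ⟶ fermatHypersurface (2 * (r + s + 1)) m) (he : e + 1 = 2 * (r + s + 1))
    {v : complexBetti (fermatHypersurface (2 * r) m) (2 * r)}
    (hv : v ∈ algebraicClasses (fermatHypersurface (2 * r) m) r)
    {w : complexBetti (fermatHypersurface (2 * s) m) (2 * s)}
    (hw : w ∈ algebraicClasses (fermatHypersurface (2 * s) m) s) :
    typeIISpanMap μ hE hX π φ he v w ∈
      algebraicClasses (fermatHypersurface (2 * (r + s + 1)) m) (r + s + 1) := by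
  rw [typeIISpanMap_apply]
  exact complexGysin_map_exterior_mem_algebraicClasses μ hE
    (isSmoothProjective_fermatHypersurface (by omega) NeZero.one_le)
    (isSmoothProjective_fermatHypersurface (by omega) NeZero.one_le) hX π φ (by omega) hv hw

/-! ### claim(α) ∧ claim(β) ⟹ claim(α∗β) from a type-II span -/

/-- **Aoki Thm. 1-4 (i) for the literal juxtaposition, granted (hΦV) for a type-II span**
(Shioda's road; no eigenspace-dimension input): if for some span
`X²ʳₘ ⊗ X²ˢₘ ←π— E —φ→ X^{2(r+s+1)}ₘ` (`π` flat, `dim E + 1 = 2(r+s+1)`, `r, s ≥ 1`) the eigenline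
`V(α∗β)` lies in the span of the values `Φ(v, w)`, `v ∈ V(α)`, `w ∈ V(β)`, of its type-II map — the
content of Shioda's Thm. I, "`f` is a `Gⁿₘ`-equivariant morphism … an isomorphism", for the
`(α∗β)`-isotypic part, whose source is `V(α) ⊗ V(β)` — then claim(α) and claim(β) imply
claim(α∗β): (hΦA) is `typeIISpanMap_mem_algebraicClasses` and the rest is
`Claim.append_of_typeII`. [cite: Shioda1979HodgeFermat, Thm. I] [cite: daSilva2021HodgeFermat, Thm. 2.2 (c) and Cor. 2.3 (a)]
[cite: Aoki1987, Thm. 1-4 (i), p. 388] -/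
theorem Claim.append_of_typeIISpan [NeZero m] (hr : 1 ≤ r) (hs : 1 ≤ s)
    {α : Fin (2 * r + 2) → ZMod m} {β : Fin (2 * s + 2) → ZMod m}
    (hE : IsSmoothProjective e E)
    (hX : IsSmoothProjective (2 * (r + s + 1)) (fermatHypersurface (2 * (r + s + 1)) m))
    (π : E ⟶ fermatHypersurface (2 * r) m ⊗ fermatHypersurface (2 * s) m) [Flat π.left]
    (φ : E ⟶ fermatHypersurface (2 * (r + s + 1)) m) (he : e + 1 = 2 * (r + s + 1))
    (hΦV : fermatEigenspace m (append α β) (2 * (r + s + 1)) ≤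
      Submodule.span ℂ (Set.image2 (fun v w ↦ typeIISpanMap μ hE hX π φ he v w)
        (fermatEigenspace m α (2 * r)) (fermatEigenspace m β (2 * s))))
    (hα : Claim m r α) (hβ : Claim m s β) : Claim m (r + s + 1) (append α β) :=
  Claim.append_of_typeII (typeIISpanMap μ hE hX π φ he)
    (fun _ hc _ hd ↦ typeIISpanMap_mem_algebraicClasses hr hs hE hX π φ he hc hd) hΦV hα hβ

/-- **Aoki Thm. 1-4 (i) for the literal juxtaposition, from a type-II span that REPRESENTS `α∗β`**
(Ran's / Aoki's road, p. 386: "if there exists an algebraic cycle `Z` on `Xⁿₘ` such that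
`ω_α(Z) ≠ 0`, then claim(α) is true"): if `dim V(α∗β) ≤ 1` (`hdim`; Aoki p. 385 "well known (see
[3], [4])", Ran Prop. 1.7 (i) — the hypothesis `hE1` of the layer's assemblies) and for some span
`X²ʳₘ ⊗ X²ˢₘ ←π— E —φ→ X^{2(r+s+1)}ₘ` (`π` flat, `dim E + 1 = 2(r+s+1)`, `r, s ≥ 1`) some value
`Φ(v, w)` with `v ∈ V(α)`, `w ∈ V(β)` has non-zero `(α∗β)`-component `π_{α∗β} Φ(v, w) ≠ 0` (`hnv`;
for Shioda's `ℙ¹`-bundle of joining lines and `v = cl Z₁`, `w = cl Z₂`: the ruled join `Z₁ ∧ Z₂`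
represents `α∗β`), then claim(α) ∧ claim(β) ⟹ claim(α∗β): by claim(α), claim(β) the classes `v`,
`w` are algebraic, so `Φ(v, w)` is algebraic (`typeIISpanMap_mem_algebraicClasses`), and
`FermatCharacter.claim_of_represents` applies. [cite: Aoki1987, Thm. 1-4 (i) p. 388, p. 386 and p. 385]
[cite: daSilva2021HodgeFermat, Thm. 2.2 (b)] [cite: Ran1980, Prop. 1.7 (i)] -/
theorem Claim.append_of_typeIISpan_represents [NeZero m] (hr : 1 ≤ r) (hs : 1 ≤ s)
    {α : Fin (2 * r + 2) → ZMod m} {β : Fin (2 * s + 2) → ZMod m}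
    (hdim : ∃ u, fermatEigenspace m (append α β) (2 * (r + s + 1)) ≤ ℂ ∙ u)
    (hE : IsSmoothProjective e E)
    (hX : IsSmoothProjective (2 * (r + s + 1)) (fermatHypersurface (2 * (r + s + 1)) m))
    (π : E ⟶ fermatHypersurface (2 * r) m ⊗ fermatHypersurface (2 * s) m) [Flat π.left]
    (φ : E ⟶ fermatHypersurface (2 * (r + s + 1)) m) (he : e + 1 = 2 * (r + s + 1))
    (hnv : ∃ v ∈ fermatEigenspace m α (2 * r), ∃ w ∈ fermatEigenspace m β (2 * s),
      fermatProjector m (append α β) (2 * (r + s + 1)) (typeIISpanMap μ hE hX π φ he v w) ≠ 0)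
    (hα : Claim m r α) (hβ : Claim m s β) : Claim m (r + s + 1) (append α β) := by
  obtain ⟨v, hv, w, hw, hne⟩ := hnv
  exact FermatCharacter.claim_of_represents hdim
    ⟨_, typeIISpanMap_mem_algebraicClasses hr hs hE hX π φ he (hα hv) (hβ hw), hne⟩

end TypeII

/-! ### Dimension `0` on one side: cone spans -/

section Cone

variable {m r s : ℕ} (μ : OrientationFamily) {e : ℕ} {E : Motives.SchemeOver ℂ}

/-- **Aoki Thm. 1-4 (i) with `r = 0`, from a cone span that represents `α∗β`.** For `α = (a, -a)` a
character of `X⁰ₘ` (`m` points of `ℙ¹`; claim(α) is automatic) and `β` a character of `X²ˢₘ`,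
`s ≥ 1`, the printed type-II variety is a union of completed cones `ℙ(O ⊕ O(-1)) → X²ˢₘ`, one for
each point of `X⁰ₘ`, mapping onto the cones joining that point to `X2 = {x = 0} ≅ X²ˢₘ` inside
`X^{2(s+1)}ₘ`. Granted a span `X²ˢₘ ←π— E —φ→ X^{2(s+1)}ₘ` (`π` flat, `dim E = 2s + 1`) and a class
`w ∈ V(β)` with `π_{α∗β}(φ_*(π^* w)) ≠ 0`, and `dim V(α∗β) ≤ 1`: claim(β) ⟹ claim(α∗β) (flat
pull-back and proper push-forward of the algebraic class `w`, then represents ⟹ claim).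
[cite: Aoki1987, Thm. 1-4 (i) p. 388 ("non-negative even integers") and p. 386] [cite: daSilva2021HodgeFermat, Thm. 2.2 (b)] -/
theorem Claim.append_of_coneSpan_represents_left [NeZero m] (hs : 1 ≤ s)
    {α : Fin (2 * 0 + 2) → ZMod m} {β : Fin (2 * s + 2) → ZMod m}
    (hdim : ∃ u, fermatEigenspace m (append α β) (2 * (0 + s + 1)) ≤ ℂ ∙ u)
    (hE : IsSmoothProjective e E)
    (hX : IsSmoothProjective (2 * (0 + s + 1)) (fermatHypersurface (2 * (0 + s + 1)) m))
    (π : E ⟶ fermatHypersurface (2 * s) m) [Flat π.left]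
    (φ : E ⟶ fermatHypersurface (2 * (0 + s + 1)) m) (he : e = 2 * s + 1)
    (hnv : ∃ w ∈ fermatEigenspace m β (2 * s),
      fermatProjector m (append α β) (2 * (0 + s + 1))
        (complexGysin μ hE hX φ
          (show 2 * s + 2 * (2 * (0 + s + 1)) = 2 * (0 + s + 1) + 2 * e by omega)
          (complexBetti.map π (2 * s) w)) ≠ 0)
    (hβ : Claim m s β) : Claim m (0 + s + 1) (append α β) := by
  obtain ⟨w, hw, hne⟩ := hnv
  exact FermatCharacter.claim_of_represents hdim
    ⟨_, complexGysin_map_mem_algebraicClasses_of_flat μ hE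
      (isSmoothProjective_fermatHypersurface (by omega) NeZero.one_le) hX π φ (by omega) (hβ hw), hne⟩

/-- **Aoki Thm. 1-4 (i) with `s = 0`, from a cone span that represents `α∗β`** (the mirror image
of `Claim.append_of_coneSpan_represents_left`: cones over `X1 = {y = 0} ≅ X²ʳₘ` with vertices the
`m` points of `X⁰ₘ`). [cite: Aoki1987, Thm. 1-4 (i) p. 388 and p. 386] [cite: daSilva2021HodgeFermat, Thm. 2.2 (b)] -/
theorem Claim.append_of_coneSpan_represents_right [NeZero m] (hr : 1 ≤ r)
    {α : Fin (2 * r + 2) → ZMod m} {β : Fin (2 * 0 + 2) → ZMod m}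
    (hdim : ∃ u, fermatEigenspace m (append α β) (2 * (r + 0 + 1)) ≤ ℂ ∙ u)
    (hE : IsSmoothProjective e E)
    (hX : IsSmoothProjective (2 * (r + 0 + 1)) (fermatHypersurface (2 * (r + 0 + 1)) m))
    (π : E ⟶ fermatHypersurface (2 * r) m) [Flat π.left]
    (φ : E ⟶ fermatHypersurface (2 * (r + 0 + 1)) m) (he : e = 2 * r + 1)
    (hnv : ∃ v ∈ fermatEigenspace m α (2 * r),
      fermatProjector m (append α β) (2 * (r + 0 + 1))
        (complexGysin μ hE hX φ
          (show 2 * r + 2 * (2 * (r + 0 + 1)) = 2 * (r + 0 + 1) + 2 * e by omega)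
          (complexBetti.map π (2 * r) v)) ≠ 0)
    (hα : Claim m r α) : Claim m (r + 0 + 1) (append α β) := by
  obtain ⟨v, hv, hne⟩ := hnv
  exact FermatCharacter.claim_of_represents hdim
    ⟨_, complexGysin_map_mem_algebraicClasses_of_flat μ hE
      (isSmoothProjective_fermatHypersurface (by omega) NeZero.one_le) hX π φ (by omega) (hα hv), hne⟩

/-- **Aoki Thm. 1-4 (i) with `r = s = 0`, from lines that represent `α∗β`.** For `α = (a, -a)`,
`β = (b, -b)` the type-II variety is the set of `m²` lines of the Fermat SURFACE `X²ₘ` joining the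
points of `X⁰ₘ × X⁰ₘ`; granted curves `φ : E → X²ₘ` (`E` smooth projective of dimension `1`) one
of whose classes `φ_* 1` has non-zero `(α∗β)`-component, and `dim V(α∗β) ≤ 1`, claim(α∗β) holds
(`φ_* 1` is algebraic: `complexGysin_one_mem_algebraicClasses`). This is the case covered in print
by the lines `L` of Thm. 1-1. [cite: Aoki1987, Thm. 1-4 (i) p. 388 and Thm. 1-1 p. 386] -/
theorem Claim.append_of_line_represents [NeZero m]
    {α : Fin (2 * 0 + 2) → ZMod m} {β : Fin (2 * 0 + 2) → ZMod m}
    (hdim : ∃ u, fermatEigenspace m (append α β) (2 * (0 + 0 + 1)) ≤ ℂ ∙ u)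
    (hE : IsSmoothProjective e E)
    (hX : IsSmoothProjective (2 * (0 + 0 + 1)) (fermatHypersurface (2 * (0 + 0 + 1)) m))
    (φ : E ⟶ fermatHypersurface (2 * (0 + 0 + 1)) m) (he : e = 1)
    (hnv : fermatProjector m (append α β) (2 * (0 + 0 + 1))
        (complexGysin μ hE hX φ (show 0 + 2 * (2 * (0 + 0 + 1)) = 2 * 1 + 2 * e by omega)
          (singularCohomology.one ℂ (Motives.ComplexPoints E))) ≠ 0) :
    Claim m (0 + 0 + 1) (append α β) :=
  FermatCharacter.claim_of_represents hdim
    ⟨_, complexGysin_one_mem_algebraicClasses μ hE hX φ (by omega), hnv⟩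

end Cone

end FermatCharacter

end Literature.AlgebraicGeometry.HodgeTheory

namespace Literature.AlgebraicGeometry.HodgeTheory

open CategoryTheory AlgebraicGeometry MonoidalCategory CartesianMonoidalCategory
open Literature.AlgebraicTopology.SingularHomology Literature.AlgebraicGeometry.Motives

/-! ### The named fact from representing spans (top-level assembly) -/

/-- **`Aoki1987_claim_juxtaposition` from its geometric inputs.** Thm. 1-4 (i) (juxtaposition up to
permutation, all `r, s ≥ 0`) follows from:
(I) `hE1` — `dim V(γ) ≤ 1` for admissible characters `γ` of `X²ᵠₘ`, `q > 0` (Aoki p. 385 "well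
known (see [3], [4])", Ran Prop. 1.7 (i); the hypothesis shared with
`Aoki1987_claim_pStandard_of_represents` and `FermatHodgeConjectureAssembly`);
(II) `hspan` — for Hodge characters `α`, `β` of `X²ʳₘ`, `X²ˢₘ`, `r, s ≥ 1`, a type-II span
`X²ʳₘ ⊗ X²ˢₘ ←π— E —φ→ X^{2(r+s+1)}ₘ` (`π` flat, `dim E + 1 = 2(r+s+1)`) one of whose values
`Φ(v, w)`, `v ∈ V(α)`, `w ∈ V(β)`, has `π_{α∗β} Φ(v, w) ≠ 0` (Shioda's `ℙ¹`-bundle of joining lines: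
"`f(Z₁ ⊗ Z₂) = m Z₁ ∧ Z₂`" and `f : V(β′) ⊗ V(γ′) ≅ V(β′∗γ′)`, da Silva Thm. 2.2 (S));
(III) `hcone_left`, `hcone_right` — the same with `X⁰ₘ` (`m` points) on one side: cone spans
`X²ˢₘ ←π— E —φ→ X^{2(s+1)}ₘ` representing `α∗β`; (IV) `hline` — for `r = s = 0` a curve
`φ : E → X²ₘ` whose class `φ_* 1` represents `α∗β` (the lines of Thm. 1-1 on the Fermat surface).
Proof: the literal form case by case (`Claim.append_of_typeIISpan_represents`,
`Claim.append_of_coneSpan_represents_left/right`, `Claim.append_of_line_represents`), then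
`Aoki1987_claim_juxtaposition_of_append` (permutations of the coordinates).
[cite: Aoki1987, Thm. 1-4 (i) p. 388, p. 386, p. 385] [cite: daSilva2021HodgeFermat, Thm. 2.2 (S) and Cor. 2.3 (a)]
[cite: Shioda1979HodgeFermat, Thm. I] [cite: Ran1980, Prop. 1.7 (i)] -/
theorem Aoki1987_claim_juxtaposition_of_spans
    (hE1 : ∀ (m q : ℕ) [NeZero m] (γ : Fin (2 * q + 2) → ZMod m), 0 < q →
      FermatCharacter.IsAdmissible γ → ∃ u, fermatEigenspace m γ (2 * q) ≤ ℂ ∙ u)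
    (hspan : ∀ (m r s : ℕ) [NeZero m] (α : Fin (2 * r + 2) → ZMod m) (β : Fin (2 * s + 2) → ZMod m),
      1 ≤ r → 1 ≤ s → FermatCharacter.IsHodge α → FermatCharacter.IsHodge β →
      ∃ (μ : OrientationFamily) (e : ℕ) (E : Motives.SchemeOver ℂ) (hE : IsSmoothProjective e E)
        (hX : IsSmoothProjective (2 * (r + s + 1)) (fermatHypersurface (2 * (r + s + 1)) m))
        (π : E ⟶ fermatHypersurface (2 * r) m ⊗ fermatHypersurface (2 * s) m) (_ : Flat π.left)
        (φ : E ⟶ fermatHypersurface (2 * (r + s + 1)) m) (he : e + 1 = 2 * (r + s + 1)),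
        ∃ v ∈ fermatEigenspace m α (2 * r), ∃ w ∈ fermatEigenspace m β (2 * s),
          fermatProjector m (FermatCharacter.append α β) (2 * (r + s + 1))
            (FermatCharacter.typeIISpanMap μ hE hX π φ he v w) ≠ 0)
    (hcone_left : ∀ (m s : ℕ) [NeZero m] (α : Fin (2 * 0 + 2) → ZMod m)
      (β : Fin (2 * s + 2) → ZMod m), 1 ≤ s → FermatCharacter.IsHodge α → FermatCharacter.IsHodge β →
      ∃ (μ : OrientationFamily) (e : ℕ) (E : Motives.SchemeOver ℂ) (hE : IsSmoothProjective e E)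
        (hX : IsSmoothProjective (2 * (0 + s + 1)) (fermatHypersurface (2 * (0 + s + 1)) m))
        (π : E ⟶ fermatHypersurface (2 * s) m) (_ : Flat π.left)
        (φ : E ⟶ fermatHypersurface (2 * (0 + s + 1)) m) (he : e = 2 * s + 1),
        ∃ w ∈ fermatEigenspace m β (2 * s),
          fermatProjector m (FermatCharacter.append α β) (2 * (0 + s + 1))
            (complexGysin μ hE hX φ
              (show 2 * s + 2 * (2 * (0 + s + 1)) = 2 * (0 + s + 1) + 2 * e by omega)
              (complexBetti.map π (2 * s) w)) ≠ 0)
    (hcone_right : ∀ (m r : ℕ) [NeZero m] (α : Fin (2 * r + 2) → ZMod m)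
      (β : Fin (2 * 0 + 2) → ZMod m), 1 ≤ r → FermatCharacter.IsHodge α → FermatCharacter.IsHodge β →
      ∃ (μ : OrientationFamily) (e : ℕ) (E : Motives.SchemeOver ℂ) (hE : IsSmoothProjective e E)
        (hX : IsSmoothProjective (2 * (r + 0 + 1)) (fermatHypersurface (2 * (r + 0 + 1)) m))
        (π : E ⟶ fermatHypersurface (2 * r) m) (_ : Flat π.left)
        (φ : E ⟶ fermatHypersurface (2 * (r + 0 + 1)) m) (he : e = 2 * r + 1),
        ∃ v ∈ fermatEigenspace m α (2 * r),
          fermatProjector m (FermatCharacter.append α β) (2 * (r + 0 + 1))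
            (complexGysin μ hE hX φ
              (show 2 * r + 2 * (2 * (r + 0 + 1)) = 2 * (r + 0 + 1) + 2 * e by omega)
              (complexBetti.map π (2 * r) v)) ≠ 0)
    (hline : ∀ (m : ℕ) [NeZero m] (α β : Fin (2 * 0 + 2) → ZMod m),
      FermatCharacter.IsHodge α → FermatCharacter.IsHodge β →
      ∃ (μ : OrientationFamily) (e : ℕ) (E : Motives.SchemeOver ℂ) (hE : IsSmoothProjective e E)
        (hX : IsSmoothProjective (2 * (0 + 0 + 1)) (fermatHypersurface (2 * (0 + 0 + 1)) m))
        (φ : E ⟶ fermatHypersurface (2 * (0 + 0 + 1)) m) (he : e = 1),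
        fermatProjector m (FermatCharacter.append α β) (2 * (0 + 0 + 1))
          (complexGysin μ hE hX φ (show 0 + 2 * (2 * (0 + 0 + 1)) = 2 * 1 + 2 * e by omega)
            (singularCohomology.one ℂ (Motives.ComplexPoints E))) ≠ 0) :
    Aoki1987_claim_juxtaposition := by
  refine Aoki1987_claim_juxtaposition_of_append fun m r s _ α β hα hβ hcα hcβ ↦ ?_
  have hdim : ∃ u, fermatEigenspace m (FermatCharacter.append α β) (2 * (r + s + 1)) ≤ ℂ ∙ u :=
    hE1 m (r + s + 1) _ (Nat.succ_pos _) (hα.append hβ).1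
  rcases Nat.eq_zero_or_pos r with rfl | hr <;> rcases Nat.eq_zero_or_pos s with rfl | hs
  · obtain ⟨μ, e, E, hE, hX, φ, he, hne⟩ := hline m α β hα hβ
    exact FermatCharacter.Claim.append_of_line_represents μ hdim hE hX φ he hne
  · obtain ⟨μ, e, E, hE, hX, π, hπ, φ, he, hnv⟩ := hcone_left m s α β hs hα hβ
    haveI := hπ
    exact FermatCharacter.Claim.append_of_coneSpan_represents_left μ hs hdim hE hX π φ he hnv hcβ
  · obtain ⟨μ, e, E, hE, hX, π, hπ, φ, he, hnv⟩ := hcone_right m r α β hr hα hβ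
    haveI := hπ
    exact FermatCharacter.Claim.append_of_coneSpan_represents_right μ hr hdim hE hX π φ he hnv hcα
  · obtain ⟨μ, e, E, hE, hX, π, hπ, φ, he, hnv⟩ := hspan m r s α β hr hs hα hβ
    haveI := hπ
    exact FermatCharacter.Claim.append_of_typeIISpan_represents hr hs hdim hE hX π φ he hnv hcα hcβ

end Literature.AlgebraicGeometry.HodgeTheory

end
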